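import Summits.Ventures.PercRepro.C025ProfilePLDParallelExt
import Summits.Ventures.PercRepro.C025ProfilePavingPLDLoops

/-!
# PER-LAYER DOMINANCE FOR EVERY MATROID OF RANK AT MOST THREE: C-025 ON EVERY TRUNCATION OF «RANK ≤ 3 ⊕ FREE POINTS»
(night-3 g30)

`proofs/NIGHT3-G30-PAREXT.md` §2.  Induction on the number of elements.  A finite matroid of rank `≤ 3` either has a
2-element circuit `{e, e'}` — a parallel pair — and then `M ＼ {e'}` has rank `≤ 3` and fewer elements while
`(M ＼ {e'}) ／ {e}` has rank `≤ 2` (g28's `PavingPLD.pld_of_eRank_le_two`), so `PLDParExt.pld_of_parallel` applies; or every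
circuit is a loop or has at least `3 ≥ rank` elements, which is g28's «paving with loops» hypothesis
(`PavingPLD.pld_of_paving_loops`).  Hence PER-LAYER DOMINANCE holds for EVERY finite matroid of rank `≤ 3`
(`pld_of_eRank_le_three`) and, by the landed bridge, C-025 holds at every `(p, q)` on every truncation of
«a matroid of rank ≤ 3 ⊕ free points» (`rls_truncate_disjointSum_freeOn_of_eRank_le_three`).
No `def`, no `instance`, no notation.  Axioms: standard.
-/

open scoped Matroid

namespace PercRepro

open Finset ThmH

namespace PLDParExt

variable {α : Type} [DecidableEq α]

omit [DecidableEq α] in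
/-- A 2-element circuit `{e, e'}` is a parallel pair: both are non-loops and each lies in the closure of the other. -/
theorem parallel_of_isCircuit_pair (M : Matroid α) {e e' : α} (hne : e ≠ e') (hC : M.IsCircuit {e, e'}) :
    M.IsNonloop e ∧ M.IsNonloop e' ∧ e' ∈ M.closure {e} ∧ e ∈ M.closure {e'} := by
  have hsub : ({e} : Set α) ⊂ {e, e'} := by
    refine Set.ssubset_iff_subset_ne.2 ⟨Set.singleton_subset_iff.2 (Set.mem_insert e {e'}), fun h => hne.symm ?_⟩
    have : e' ∈ ({e} : Set α) := h ▸ Set.mem_insert_of_mem e (Set.mem_singleton e')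
    exact Set.mem_singleton_iff.1 this
  have hsub' : ({e'} : Set α) ⊂ {e, e'} := by
    refine Set.ssubset_iff_subset_ne.2
      ⟨Set.singleton_subset_iff.2 (Set.mem_insert_of_mem e (Set.mem_singleton e')), fun h => hne ?_⟩
    have : e ∈ ({e'} : Set α) := h ▸ Set.mem_insert e {e'}
    exact Set.mem_singleton_iff.1 this
  refine ⟨Matroid.indep_singleton.1 (hC.ssubset_indep hsub), Matroid.indep_singleton.1 (hC.ssubset_indep hsub'),
    ?_, ?_⟩
  · have h := hC.mem_closure_sdiff_singleton_of_mem (Set.mem_insert_of_mem e (Set.mem_singleton e'))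
    rwa [Set.pair_sdiff_right hne] at h
  · have h := hC.mem_closure_sdiff_singleton_of_mem (Set.mem_insert e {e'})
    rwa [Set.pair_sdiff_left hne] at h

omit [DecidableEq α] in
/-- The rank of a deletion is at most the rank. -/
theorem eRank_delete_le (M : Matroid α) (D : Set α) : (M ＼ D).eRank ≤ M.eRank := by
  rw [Matroid.eRank_def, Matroid.eRank_def, Matroid.delete_ground, eRk_delete_of_subset M D _ le_rfl]
  exact M.eRk_mono Set.sdiff_subset

omit [DecidableEq α] in
/-- The rank of `M ／ {e}` plus one is the rank of `M`, for a non-loop `e`. -/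
theorem eRank_contract_singleton_add_one (M : Matroid α) {e : α} (he : M.IsNonloop e) :
    (M ／ {e}).eRank + 1 = M.eRank := by
  rw [Matroid.eRank_def, Matroid.eRank_def, Matroid.contract_ground, eRk_contract_singleton_add_one M he,
    Set.insert_sdiff_singleton, Set.insert_eq_of_mem he.mem_ground]

/-- PER-LAYER DOMINANCE FOR EVERY FINITE MATROID OF RANK `≤ 3`, in the hPLD binder of
`PLDBridge.rls_disjointSum_freeOn_of_pld`. -/
theorem pld_of_eRank_le_three (M : Matroid α) [M.Finite] (h3 : M.eRank ≤ 3) :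
    ∀ lo hi δ Θ : ℕ, Θ ≤ lo + hi + δ → (lo = 0 ∨ lo + hi + δ ≤ Θ) →
      (∑ I ∈ (gr M).powerset, (if lo ≤ (M.eRk (I : Set α)).toNat ∧ (M.eRk (I : Set α)).toNat ≤ hi ∧
          Θ ≤ (M.eRk ((gr M \ I : Finset α) : Set α)).toNat + (M.eRk (I : Set α)).toNat then
          ((M.eRk ((gr M \ I : Finset α) : Set α)).toNat).choose δ else 0)) ≤
        ∑ I ∈ (gr M).powerset, (if lo + δ ≤ (M.eRk ((gr M \ I : Finset α) : Set α)).toNat ∧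
          (M.eRk ((gr M \ I : Finset α) : Set α)).toNat ≤ hi + δ then
          ((M.eRk ((gr M \ I : Finset α) : Set α)).toNat).choose δ else 0) := by
  suffices H : ∀ n : ℕ, ∀ (M : Matroid α) [M.Finite], (gr M).card = n → M.eRank ≤ 3 →
      ∀ lo hi δ Θ : ℕ, Θ ≤ lo + hi + δ → (lo = 0 ∨ lo + hi + δ ≤ Θ) →
      (∑ I ∈ (gr M).powerset, (if lo ≤ (M.eRk (I : Set α)).toNat ∧ (M.eRk (I : Set α)).toNat ≤ hi ∧
          Θ ≤ (M.eRk ((gr M \ I : Finset α) : Set α)).toNat + (M.eRk (I : Set α)).toNat then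
          ((M.eRk ((gr M \ I : Finset α) : Set α)).toNat).choose δ else 0)) ≤
        ∑ I ∈ (gr M).powerset, (if lo + δ ≤ (M.eRk ((gr M \ I : Finset α) : Set α)).toNat ∧
          (M.eRk ((gr M \ I : Finset α) : Set α)).toNat ≤ hi + δ then
          ((M.eRk ((gr M \ I : Finset α) : Set α)).toNat).choose δ else 0) from H _ M rfl h3
  intro n
  induction n using Nat.strong_induction_on with
  | _ n ih =>
  intro M _ hn h3
  by_cases hex : ∃ e e' : α, e ≠ e' ∧ M.IsCircuit {e, e'}
  · -- a parallel pair: delete `e'`, contract `e`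
    obtain ⟨e, e', hne, hC⟩ := hex
    obtain ⟨he, he', hcl, hcl'⟩ := parallel_of_isCircuit_pair M hne hC
    have he'M : e' ∈ gr M := by rw [← Finset.mem_coe, coe_gr]; exact he'.mem_ground
    have hcard : (gr (M ＼ {e'})).card < n := by
      rw [gr_delete_singleton, ← hn]
      exact Finset.card_erase_lt_of_mem he'M
    have hN3 : (M ＼ {e'}).eRank ≤ 3 := (eRank_delete_le M {e'}).trans h3
    have hC2 : ((M ＼ {e'}) ／ {e}).eRank ≤ 2 := by
      have hNe : (M ＼ {e'}).IsNonloop e := Matroid.delete_isNonloop_iff.2 ⟨he, by simpa using hne⟩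
      have h := eRank_contract_singleton_add_one (M ＼ {e'}) hNe
      obtain ⟨a, ha⟩ : ∃ a : ℕ, ((M ＼ {e'}) ／ {e}).eRank = a :=
        ⟨_, (ENat.coe_toNat ((Matroid.eRank_ne_top_iff _).2 inferInstance)).symm⟩
      rw [ha] at h ⊢
      rw [← h] at hN3
      have : a + 1 ≤ 3 := by exact_mod_cast hN3
      exact_mod_cast (show a ≤ 2 by omega)
    exact pld_of_parallel M hne he he' hcl hcl' (ih _ hcard (M ＼ {e'}) rfl hN3)
      (PavingPLD.pld_of_eRank_le_two _ hC2)
  · -- no 2-circuit: every circuit is a loop or has `≥ 3 ≥ rank` elements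
    apply PavingPLD.pld_of_paving_loops
    intro C hC
    push Not at hex
    have hfin : C.Finite := M.ground_finite.subset hC.subset_ground
    rw [← hfin.cast_ncard_eq]
    rcases Nat.lt_or_ge C.ncard 3 with hlt | hge
    · interval_cases h : C.ncard
      · exact absurd ((Set.ncard_eq_zero hfin).1 h) hC.nonempty.ne_empty
      · left; rfl
      · obtain ⟨x, y, hxy, rfl⟩ := Set.ncard_eq_two.1 h
        exact absurd hC (hex x y hxy)
    · right
      exact h3.trans (by exact_mod_cast hge)

/-- C-025 AT EVERY `(p, q)` ON EVERY TRUNCATION OF «A MATROID OF RANK `≤ 3` ⊕ FREE POINTS». -/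
theorem rls_truncate_disjointSum_freeOn_of_eRank_le_three (M : Matroid α) [M.Finite] (h3 : M.eRank ≤ 3)
    (E₃ : Finset α) (h : Disjoint M.E (E₃ : Set α)) (r p q : ℕ) :
    haveI := PLDBridge.disjointSum_freeOn_finite M E₃ h
    ThmN.RLS (PercRepro.Matroid.truncate (M.disjointSum (Matroid.freeOn (E₃ : Set α)) h) r) p q :=
  PLDBridge.rls_disjointSum_freeOn_of_pld M E₃ h r p q (pld_of_eRank_le_three M h3)

end PLDParExt

end PercRepro
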